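import Summits.Schanuel.Schanuel.Theorems.ZilberEacGraphLinearSurface
import Summits.Schanuel.Schanuel.Theorems.ZilberEacGraphSurfaceResidual
import Mathlib.FieldTheory.IsAlgClosed.Basic
import HarnessLib

/-!
# The equimodular class, XVII: the `y₀`-linear class over polynomial graphs is COMPLETELY decided;
# the literal residual over graph bases has `y₀`-degree `≥ 2` (or a constant fibre)

HONEST FRAMING.  Cell `pub-schanuel` (Zilber's Exponential-Algebraic Closedness, case ladder;
host summit Schanuel), seat 2, gen 23.
* **`unprojectedDense_graph_linearFibre`**: `deg p ≥ 2`, `P ∈ ℂ[x₀, y₀]` irreducible, `y₀`-LINEAR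
  (every monomial has `y₀`-degree `≤ 1`), with both `y₀`-degrees present and some monomial of positive
  `x₀`-degree.  Then `{x₁ = p(x₀), P(x₀, y₀) = 0}` has Zariski-dense exponential points.  (By gen 18's
  residual theorem the two rows `A = [y₀¹]P`, `B = [y₀⁰]P` have equal degree `≥ 1` unless the surface is
  already dense; they are coprime by irreducibility; then file XVI.)
* **`mmCase_graphBase_residual_nonlinear`**: a surface of Mantova–Masser's case over a polynomial
  graph of degree `≥ 2` WITHOUT Zariski-dense exponential points is a cylinder over an irreducible fibre
  curve `P₂` (with all of gen 18's equimodular conditions) which moreover has a monomial of `y₀`-degree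
  `≥ 2`, or is a constant fibre `P₂ ∈ ℂ[y₀]` (the non-free class `y₀ = θ`, where density CAN fail:
  `{x₁ = x₀²/(2πi), y₀ = 1}`, seat 1 gen 9).
* Examples: `{x₁ = c·x₀^d, x₀ y₀ = x₀ + 1}` for every `d ≥ 2`, `c ≠ 0` (`e^{x₁}` where `e^{x₀} = 1 + 1/x₀`),
  in particular `{x₁ = x₀³, x₀ y₀ = x₀ + 1}` (totally degenerate and NON-resonant: the phases
  `e^{i(8π³k³ - 6πk)}`… do not converge, yet the exponential points are dense).
Complete classes of instances of an OPEN question (Mantova–Masser, PLMS 2024 §1 p. 5); fibre curves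
of `y₀`-degree `≥ 2` and non-graph bases remain; EC(3,2) OPEN; NOT Schanuel's conjecture (neither
used nor implied; EAC ⇏ SC).
-/

noncomputable section

open Filter Topology Set Complex MvPolynomial
open Literature.NumberTheory.Transcendental Literature.ModelTheory.Zilber
open Literature.ModelTheory.ExponentialFields

set_option linter.dupNamespace false

namespace Summit.Schanuel.Schanuel.Theorems

/-! ## Part A. The two rows of a `y₀`-linear polynomial -/

section Rows

variable (P : MvPolynomial (Fin 2) ℂ)

/-- **Evaluation of a `y₀`-linear polynomial through its two rows**:
`P(x, y) = A(x)·y + B(x)` with `A = Σ_{v₁ = 1} P_v X^{v₀}`, `B = Σ_{v₁ = 0} P_v X^{v₀}`. [folklore] -/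
theorem eval_eq_rows_of_linear (hlin : ∀ v ∈ P.support, v 1 ≤ 1) (x y : ℂ) :
    MvPolynomial.eval ![x, y] P =
      (∑ v ∈ P.support.filter (fun v : Fin 2 →₀ ℕ => v 1 = 1),
          Polynomial.monomial (v 0) (P.coeff v)).eval x * y +
        (∑ v ∈ P.support.filter (fun v : Fin 2 →₀ ℕ => v 1 = 0),
          Polynomial.monomial (v 0) (P.coeff v)).eval x := by
  classical
  rw [MvPolynomial.eval_eq', Polynomial.eval_finsetSum, Polynomial.eval_finsetSum, Finset.sum_mul,
    ← Finset.sum_filter_add_sum_filter_not P.support (fun v : Fin 2 →₀ ℕ => v 1 = 1)]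
  congr 1
  · refine Finset.sum_congr rfl fun v hv => ?_
    obtain ⟨-, hv1⟩ := Finset.mem_filter.1 hv
    rw [Fin.prod_univ_two, Polynomial.eval_monomial]
    simp only [Matrix.cons_val_zero, Matrix.cons_val_one, hv1, pow_one]
    ring
  · have hfilt : P.support.filter (fun v : Fin 2 →₀ ℕ => ¬ v 1 = 1) =
        P.support.filter (fun v : Fin 2 →₀ ℕ => v 1 = 0) := by
      refine Finset.filter_congr fun v hv => ?_
      have := hlin v hv
      omega
    rw [hfilt]
    refine Finset.sum_congr rfl fun v hv => ?_
    obtain ⟨-, hv1⟩ := Finset.mem_filter.1 hv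
    rw [Fin.prod_univ_two, Polynomial.eval_monomial]
    simp [hv1]

/-- Coefficients of the row `Σ_{v₁ = e} P_v X^{v₀}`: `[X^n] = P_{(n, e)}`. [folklore] -/
theorem coeff_row (e n : ℕ) :
    (∑ v ∈ P.support.filter (fun v : Fin 2 →₀ ℕ => v 1 = e),
        Polynomial.monomial (v 0) (P.coeff v)).coeff n =
      P.coeff (Finsupp.single 0 n + Finsupp.single 1 e) := by
  classical
  have hfin : ∀ u : Fin 2 →₀ ℕ, u = Finsupp.single 0 (u 0) + Finsupp.single 1 (u 1) := fun u => by
    ext i; fin_cases i <;> simp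
  set v₀ : Fin 2 →₀ ℕ := Finsupp.single 0 n + Finsupp.single 1 e with hv₀
  have hv₀0 : v₀ 0 = n := by simp [hv₀]
  have hv₀1 : v₀ 1 = e := by simp [hv₀]
  rw [Polynomial.finsetSum_coeff]
  simp only [Polynomial.coeff_monomial]
  by_cases hmem : v₀ ∈ P.support
  · rw [Finset.sum_eq_single v₀]
    · rw [if_pos hv₀0]
    · intro v hv hne
      obtain ⟨-, hv1⟩ := Finset.mem_filter.1 hv
      rw [if_neg]
      intro h0
      apply hne
      rw [hfin v, h0, hv1]
    · intro h
      exact absurd (Finset.mem_filter.2 ⟨hmem, hv₀1⟩) h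
  · rw [Finset.sum_eq_zero, (MvPolynomial.notMem_support_iff.1 hmem)]
    intro v hv
    obtain ⟨hvs, hv1⟩ := Finset.mem_filter.1 hv
    rw [if_neg]
    intro h0
    apply hmem
    rwa [hv₀, ← h0, ← hv1, ← hfin v]

/-- **Degree of a row attaining the maximal `x₀`-degree `N₀` at `y₀`-degree `e`**: it is `N₀`, and its
leading coefficient is `P_{(N₀, e)}`. [folklore] -/
theorem natDegree_row_eq {N₀ e : ℕ} (hN₀ : ∀ v ∈ P.support, v 0 ≤ N₀) {vR : Fin 2 →₀ ℕ}
    (hvR : vR ∈ P.support) (hvR0 : vR 0 = N₀) (hvR1 : vR 1 = e) :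
    (∑ v ∈ P.support.filter (fun v : Fin 2 →₀ ℕ => v 1 = e),
        Polynomial.monomial (v 0) (P.coeff v)).natDegree = N₀ ∧
      (∑ v ∈ P.support.filter (fun v : Fin 2 →₀ ℕ => v 1 = e),
        Polynomial.monomial (v 0) (P.coeff v)).leadingCoeff =
        P.coeff (Finsupp.single 0 N₀ + Finsupp.single 1 e) := by
  classical
  have hfin : ∀ u : Fin 2 →₀ ℕ, u = Finsupp.single 0 (u 0) + Finsupp.single 1 (u 1) := fun u => by
    ext i; fin_cases i <;> simp
  have hvReq : vR = Finsupp.single 0 N₀ + Finsupp.single 1 e := by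
    rw [hfin vR, hvR0, hvR1]
  have htop : (∑ v ∈ P.support.filter (fun v : Fin 2 →₀ ℕ => v 1 = e),
      Polynomial.monomial (v 0) (P.coeff v)).coeff N₀ ≠ 0 := by
    rw [coeff_row, ← hvReq]
    exact MvPolynomial.mem_support_iff.1 hvR
  have hdeg : (∑ v ∈ P.support.filter (fun v : Fin 2 →₀ ℕ => v 1 = e),
      Polynomial.monomial (v 0) (P.coeff v)).natDegree = N₀ := by
    refine le_antisymm ?_ (Polynomial.le_natDegree_of_ne_zero htop)
    rw [Polynomial.natDegree_le_iff_coeff_eq_zero]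
    intro m hm
    have hm' : N₀ < m := by exact_mod_cast hm
    rw [coeff_row]
    refine MvPolynomial.notMem_support_iff.1 fun h => ?_
    have := hN₀ _ h
    simp at this
    omega
  refine ⟨hdeg, ?_⟩
  rw [Polynomial.leadingCoeff, hdeg, coeff_row]

/-- Evaluating `A(X_i)` (a one-variable polynomial substituted into a variable) at a point.
[folklore] -/
theorem mvEval_aeval_X (i : Fin 2) (A : Polynomial ℂ) (xs : Fin 2 → ℂ) :
    MvPolynomial.eval xs (Polynomial.aeval (X i : MvPolynomial (Fin 2) ℂ) A) = A.eval (xs i) := by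
  induction A using Polynomial.induction_on' with
  | add p q hp hq => simp only [map_add, Polynomial.eval_add, hp, hq]
  | monomial n a =>
    simp only [Polynomial.aeval_monomial, MvPolynomial.algebraMap_eq, map_mul, map_pow,
      MvPolynomial.eval_C, MvPolynomial.eval_X, Polynomial.eval_monomial]

/-- **The MvPolynomial identity `P = A(X₀)·X₁ + B(X₀)`** for a `y₀`-linear `P`. [folklore] -/
theorem eq_rows_of_linear (hlin : ∀ v ∈ P.support, v 1 ≤ 1) :
    P = Polynomial.aeval (X 0 : MvPolynomial (Fin 2) ℂ)
          (∑ v ∈ P.support.filter (fun v : Fin 2 →₀ ℕ => v 1 = 1),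
            Polynomial.monomial (v 0) (P.coeff v)) * X 1 +
        Polynomial.aeval (X 0 : MvPolynomial (Fin 2) ℂ)
          (∑ v ∈ P.support.filter (fun v : Fin 2 →₀ ℕ => v 1 = 0),
            Polynomial.monomial (v 0) (P.coeff v)) := by
  refine MvPolynomial.funext fun xs => ?_
  have hxs : xs = ![xs 0, xs 1] := by
    funext i; fin_cases i <;> rfl
  rw [map_add, map_mul, MvPolynomial.eval_X, mvEval_aeval_X, mvEval_aeval_X]
  conv_lhs => rw [hxs, eval_eq_rows_of_linear P hlin]

/-- **Coprimality of the rows from irreducibility.**  If `P = A(x₀) y₀ + B(x₀)` is irreducible and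
`A ≠ 0`, then `A, B` are coprime (a common root `t` would make `x₀ - t` a proper factor). [folklore] -/
theorem isCoprime_rows_of_irreducible {A B : Polynomial ℂ} (hA : A ≠ 0)
    (hPAB : P = Polynomial.aeval (X 0 : MvPolynomial (Fin 2) ℂ) A * X 1 +
      Polynomial.aeval (X 0 : MvPolynomial (Fin 2) ℂ) B)
    (hirr : Irreducible P) : IsCoprime A B := by
  rw [Polynomial.isCoprime_iff_aeval_ne_zero_of_isAlgClosed ℂ ℂ]
  intro t
  by_contra hboth
  push Not at hboth
  obtain ⟨hAt, hBt⟩ := hboth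
  rw [Polynomial.coe_aeval_eq_eval] at hAt hBt
  obtain ⟨A₁, hA₁⟩ := (Polynomial.dvd_iff_isRoot.2 hAt : Polynomial.X - Polynomial.C t ∣ A)
  obtain ⟨B₁, hB₁⟩ := (Polynomial.dvd_iff_isRoot.2 hBt : Polynomial.X - Polynomial.C t ∣ B)
  set L : MvPolynomial (Fin 2) ℂ := X 0 - MvPolynomial.C t with hL
  set Q : MvPolynomial (Fin 2) ℂ := Polynomial.aeval (X 0 : MvPolynomial (Fin 2) ℂ) A₁ * X 1 +
    Polynomial.aeval (X 0 : MvPolynomial (Fin 2) ℂ) B₁ with hQ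
  have hfac : P = L * Q := by
    rw [hPAB, hA₁, hB₁, hQ, hL, map_mul, map_mul, map_sub, Polynomial.aeval_X, Polynomial.aeval_C,
      MvPolynomial.algebraMap_eq]
    ring
  have hA₁0 : A₁ ≠ 0 := by
    rintro rfl; rw [mul_zero] at hA₁; exact hA hA₁
  -- neither factor is a unit: both have a zero
  have hLnu : ¬ IsUnit L := by
    intro hu
    have h := (hu.map (MvPolynomial.eval ![t, 0])).ne_zero
    apply h
    simp [hL]
  have hQnu : ¬ IsUnit Q := by
    intro hu
    -- a point `s` with `A₁(s) ≠ 0` and `y = -B₁(s)/A₁(s)`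
    obtain ⟨s, hs⟩ : ∃ s : ℂ, A₁.eval s ≠ 0 := by
      by_contra h
      push Not at h
      exact hA₁0 (Polynomial.funext fun s => by simpa using h s)
    have h := (hu.map (MvPolynomial.eval ![s, -B₁.eval s / A₁.eval s])).ne_zero
    apply h
    rw [hQ, map_add, map_mul, MvPolynomial.eval_X, mvEval_aeval_X, mvEval_aeval_X]
    simp only [Matrix.cons_val_zero, Matrix.cons_val_one]
    field_simp
    ring
  rcases hirr.isUnit_or_isUnit hfac with h | h
  · exact hLnu h
  · exact hQnu h

end Rows

/-! ## Part B. The `y₀`-linear class over polynomial graphs is completely decided -/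

section Complete

variable (p : Polynomial ℂ) {P : MvPolynomial (Fin 2) ℂ}

/-- **THE `y₀`-LINEAR CLASS OVER POLYNOMIAL GRAPHS OF DEGREE `≥ 2` IS DENSE.**  `P ∈ ℂ[x₀, y₀]`
irreducible with all monomials of `y₀`-degree `≤ 1`, both `y₀`-degrees `0, 1` present, and some monomial
of positive `x₀`-degree (the fibre root is a NON-CONSTANT rational function of `x₀`).  Then
`{x₁ = p(x₀), P(x₀, y₀) = 0}` has Zariski-dense exponential points — whatever `p` of degree `≥ 2`.
[cite: MantovaMasser2023, §1 Further remarks, p. 5 (the question, open in general)] (new) -/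
theorem unprojectedDense_graph_linearFibre (hd : 2 ≤ p.natDegree) (hirr : Irreducible P)
    (h1 : ∃ v ∈ P.support, ∃ v' ∈ P.support, v 1 ≠ v' 1) (hlin : ∀ v ∈ P.support, v 1 ≤ 1)
    (hx : ∃ v ∈ P.support, 0 < v 0) :
    UnprojectedDense {w : Fin 2 ⊕ Fin 2 → ℂ | w (Sum.inl 1) = p.eval (w (Sum.inl 0)) ∧
      MvPolynomial.eval ![w (Sum.inl 0), w (Sum.inr 0)] P = 0} := by
  classical
  by_contra hnot
  obtain ⟨-, hrow, -⟩ := fibreCurveSurface_residual_of_not_unprojectedDense p hd hirr h1 hnot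
  -- the maximal `x₀`-degree `N₀ ≥ 1`
  have hsne : P.support.Nonempty := MvPolynomial.support_nonempty.2 hirr.ne_zero
  obtain ⟨v₀, hv₀, hv₀max⟩ := Finset.exists_max_image P.support (fun v : Fin 2 →₀ ℕ => v 0) hsne
  set N₀ : ℕ := v₀ 0 with hN₀
  have hN₀max : ∀ v ∈ P.support, v 0 ≤ N₀ := fun v hv => hv₀max v hv
  have hN₀pos : 1 ≤ N₀ := by
    obtain ⟨v, hv, hvpos⟩ := hx
    exact le_trans hvpos (hN₀max v hv)
  obtain ⟨⟨vR, hvR, hvR0, hvRmax⟩, ⟨vL, hvL, hvL0, hvLmin⟩⟩ := hrow v₀ hv₀ hN₀max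
  -- the extreme `y₀`-degrees are `1` and `0`
  have hvR1 : vR 1 = 1 := by
    refine le_antisymm (hlin vR hvR) ?_
    by_contra hlt
    have h0 : vR 1 = 0 := by omega
    obtain ⟨v, hv, v', hv', hne⟩ := h1
    have := hvRmax v hv; have := hvRmax v' hv'; omega
  have hvL1 : vL 1 = 0 := by
    by_contra hne0
    have h1' : vL 1 = 1 := by have := hlin vL hvL; omega
    obtain ⟨v, hv, v', hv', hne⟩ := h1
    have := hvLmin v hv; have := hvLmin v' hv'; have := hlin v hv; have := hlin v' hv'; omega
  -- the rows
  set A : Polynomial ℂ := ∑ v ∈ P.support.filter (fun v : Fin 2 →₀ ℕ => v 1 = 1),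
    Polynomial.monomial (v 0) (P.coeff v) with hA
  set B : Polynomial ℂ := ∑ v ∈ P.support.filter (fun v : Fin 2 →₀ ℕ => v 1 = 0),
    Polynomial.monomial (v 0) (P.coeff v) with hB
  have hP : ∀ x y : ℂ, MvPolynomial.eval ![x, y] P = A.eval x * y + B.eval x :=
    eval_eq_rows_of_linear P hlin
  obtain ⟨hAdeg, hAlc⟩ : A.natDegree = N₀ ∧
      A.leadingCoeff = P.coeff (Finsupp.single 0 N₀ + Finsupp.single 1 1) :=
    natDegree_row_eq P hN₀max hvR hvR0 hvR1
  obtain ⟨hBdeg, hBlc⟩ : B.natDegree = N₀ ∧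
      B.leadingCoeff = P.coeff (Finsupp.single 0 N₀ + Finsupp.single 1 0) :=
    natDegree_row_eq P hN₀max hvL hvL0 hvL1
  have hA0 : A ≠ 0 :=
    Polynomial.ne_zero_of_natDegree_gt (show 0 < A.natDegree by rw [hAdeg]; exact hN₀pos)
  have hlcA : A.leadingCoeff ≠ 0 := Polynomial.leadingCoeff_ne_zero.2 hA0
  have hlcB : B.leadingCoeff ≠ 0 := by
    rw [hBlc]
    have : vL = Finsupp.single 0 N₀ + Finsupp.single 1 0 := by
      ext i; fin_cases i <;> simp [hvL0, hvL1, hN₀]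
    rw [← this]
    exact MvPolynomial.mem_support_iff.1 hvL
  have hcop : IsCoprime A B := isCoprime_rows_of_irreducible P hA0 (eq_rows_of_linear P hlin) hirr
  -- the fibre limit `θ = -lc B / lc A = e^{τ'}`
  set θ : ℂ := -B.leadingCoeff / A.leadingCoeff with hθ
  have hθ0 : θ ≠ 0 := div_ne_zero (neg_ne_zero.2 hlcB) hlcA
  set τ' : ℂ := Complex.log θ with hτ'
  have hlc : B.leadingCoeff = -Complex.exp τ' * A.leadingCoeff := by
    rw [hτ', Complex.exp_log hθ0, hθ]
    field_simp
  exact hnot (unprojectedDense_graphLinearSurface A B hP hirr (by rw [hAdeg]; exact hN₀pos)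
    (by rw [hAdeg, hBdeg]) hcop p hd τ' hlc)

/-- **Case ∧ dense for the `y₀`-linear class**, when moreover `P(t, ·)` has a nonzero root for
infinitely many `t`. [cite: MantovaMasser2023, §1 Further remarks, p. 5 (the question, open in
general)] (new) -/
theorem unprojectedDensityQuestion_graph_linearFibre (hd : 2 ≤ p.natDegree) (hirr : Irreducible P)
    (h1 : ∃ v ∈ P.support, ∃ v' ∈ P.support, v 1 ≠ v' 1) (hlin : ∀ v ∈ P.support, v 1 ≤ 1)
    (hx : ∃ v ∈ P.support, 0 < v 0)
    (hfib : Set.Infinite {t : ℂ | ∃ y : ℂ, y ≠ 0 ∧ MvPolynomial.eval ![t, y] P = 0}) :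
    MMCaseDimPiOneFree {w : Fin 2 ⊕ Fin 2 → ℂ | w (Sum.inl 1) = p.eval (w (Sum.inl 0)) ∧
      MvPolynomial.eval ![w (Sum.inl 0), w (Sum.inr 0)] P = 0} ∧
    UnprojectedDense {w : Fin 2 ⊕ Fin 2 → ℂ | w (Sum.inl 1) = p.eval (w (Sum.inl 0)) ∧
      MvPolynomial.eval ![w (Sum.inl 0), w (Sum.inr 0)] P = 0} :=
  ⟨mmCase_fibreCurveSurface p hd hirr hfib, unprojectedDense_graph_linearFibre p hd hirr h1 hlin hx⟩

end Complete

/-! ## Part C. The literal residual over polynomial graphs: `y₀`-degree `≥ 2` or a constant fibre -/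

section Residual

variable (p : Polynomial ℂ)

/-- **The residual theorem over polynomial graphs of degree `≥ 2`, sharpened.**  A surface of
Mantova–Masser's case over the graph `x₁ = p(x₀)` without Zariski-dense exponential points is
`{x₁ = p(x₀), P₂(x₀, y₀) = 0}` for an irreducible `P₂` with two `y₀`-degrees satisfying gen 18's
equimodular conditions AND: `P₂` has a monomial of `y₀`-degree `≥ 2`, or `P₂ ∈ ℂ[y₀]` (constant fibre,
not multiplicatively free).  [cite: MantovaMasser2023, §1 Further remarks, p. 5 (the question, open in
general)] (new) -/
theorem mmCase_graphBase_residual_nonlinear (hd : 2 ≤ p.natDegree) {W : Set (Fin 2 ⊕ Fin 2 → ℂ)}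
    (hmm : MMCaseDimPiOneFree W)
    (hbase : zeroLocus ℂ (vanishingIdeal ℂ (projAdd '' (W ∩ torusLocus ℂ 2))) =
      {x : Fin 2 → ℂ | x 1 = p.eval (x 0)})
    (hnot : ¬ UnprojectedDense W) :
    ∃ P₂ : MvPolynomial (Fin 2) ℂ, Irreducible P₂ ∧
      (∃ v ∈ P₂.support, ∃ v' ∈ P₂.support, v 1 ≠ v' 1) ∧
      W = {w : Fin 2 ⊕ Fin 2 → ℂ | w (Sum.inl 1) = p.eval (w (Sum.inl 0)) ∧
        MvPolynomial.eval ![w (Sum.inl 0), w (Sum.inr 0)] P₂ = 0} ∧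
      (p.leadingCoeff * I ^ p.natDegree).re = 0 ∧
      (∀ v₀ ∈ P₂.support, (∀ v ∈ P₂.support, v 0 ≤ v₀ 0) →
        (∃ vR ∈ P₂.support, vR 0 = v₀ 0 ∧ ∀ u ∈ P₂.support, u 1 ≤ vR 1) ∧
        (∃ vL ∈ P₂.support, vL 0 = v₀ 0 ∧ ∀ u ∈ P₂.support, vL 1 ≤ u 1)) ∧
      (∀ N₀ : ℕ, (∀ v ∈ P₂.support, v 0 ≤ N₀) → ∀ va ∈ P₂.support, ∀ vc ∈ P₂.support,
        va 0 = N₀ → vc 0 = N₀ → va 1 ≠ vc 1 → ∀ θ : ℂ, θ ≠ 0 →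
        (∑ v ∈ P₂.support.filter (fun v : Fin 2 →₀ ℕ => v 0 = N₀),
          Polynomial.C (P₂.coeff v) * Polynomial.X ^ (v 1)).eval θ = 0 →
        (p.natDegree : ℝ) * (p.leadingCoeff * I ^ (p.natDegree - 1)).re * Real.log ‖θ‖ +
          (p.coeff (p.natDegree - 1) * I ^ (p.natDegree - 1)).re = 0) ∧
      ((∃ v ∈ P₂.support, 2 ≤ v 1) ∨ (∀ v ∈ P₂.support, v 0 = 0)) := by
  obtain ⟨P₂, hirr₂, h1, hW₂, hre, hrow, hroot⟩ := mmCase_graphBase_residual p hd hmm hbase hnot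
  refine ⟨P₂, hirr₂, h1, hW₂, hre, hrow, hroot, ?_⟩
  by_contra hneither
  push Not at hneither
  obtain ⟨hlin, ⟨v, hv, hv0⟩⟩ := hneither
  have hlin' : ∀ v ∈ P₂.support, v 1 ≤ 1 := fun v hv => by have := hlin v hv; omega
  have hx : ∃ v ∈ P₂.support, 0 < v 0 := ⟨v, hv, Nat.pos_of_ne_zero hv0⟩
  apply hnot
  rw [hW₂]
  exact unprojectedDense_graph_linearFibre p hd hirr₂ h1 hlin' hx

end Residual

/-! ## Part D. Examples: `{x₁ = c·x₀^d, x₀ y₀ = x₀ + 1}` (`d ≥ 2`, `c ≠ 0`) -/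

section Examples

/-- **`{x₁ = c·x₀^d, x₀ y₀ = x₀ + 1}` is in Mantova–Masser's case and DENSE for every `d ≥ 2`,
`c ≠ 0`**: `e^{x₁} = exp(c·x₀^d)` where `e^{x₀} = 1 + 1/x₀`.  For `c ∈ ℝ` and odd `d`, or `c ∈ iℝ` and
even `d`, the surface is totally degenerate (`|e^{x₁}|` bounded along all exponential points; THEOREM G
is silent) — the transcendence / Kronecker mechanisms decide it.
[cite: MantovaMasser2023, §1 Further remarks, p. 5 (the question, open in general)] (new) -/
theorem unprojectedDensityQuestion_monomialGraph_ratFibre {c : ℂ} (hc : c ≠ 0) {d : ℕ} (hd : 2 ≤ d) :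
    MMCaseDimPiOneFree {w : Fin 2 ⊕ Fin 2 → ℂ |
      w (Sum.inl 1) = c * w (Sum.inl 0) ^ d ∧ w (Sum.inl 0) * w (Sum.inr 0) - w (Sum.inl 0) - 1 = 0} ∧
    UnprojectedDense {w : Fin 2 ⊕ Fin 2 → ℂ |
      w (Sum.inl 1) = c * w (Sum.inl 0) ^ d ∧ w (Sum.inl 0) * w (Sum.inr 0) - w (Sum.inl 0) - 1 = 0} := by
  have hset : {w : Fin 2 ⊕ Fin 2 → ℂ |
      w (Sum.inl 1) = c * w (Sum.inl 0) ^ d ∧ w (Sum.inl 0) * w (Sum.inr 0) - w (Sum.inl 0) - 1 = 0} =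
      {w : Fin 2 ⊕ Fin 2 → ℂ |
        w (Sum.inl 1) = (Polynomial.C c * Polynomial.X ^ d).eval (w (Sum.inl 0)) ∧
        MvPolynomial.eval ![w (Sum.inl 0), w (Sum.inr 0)]
          (X 0 * X 1 - X 0 - 1 : MvPolynomial (Fin 2) ℂ) = 0} := by
    ext w
    simp only [Set.mem_setOf_eq, Polynomial.eval_mul, Polynomial.eval_C, Polynomial.eval_pow,
      Polynomial.eval_X, MvPolynomial.eval_X, map_sub, map_mul, map_one, Matrix.cons_val_zero,
      Matrix.cons_val_one]
  rw [hset]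
  refine unprojectedDensityQuestion_graphLinearSurface Polynomial.X (-Polynomial.X - 1)
    eval_resonantP irreducible_resonantP (by simp) ?_ ?_ _ ?_ 0 ?_
  · rw [Polynomial.natDegree_X, show (-Polynomial.X - 1 : Polynomial ℂ) = -(Polynomial.X + Polynomial.C 1)
      by rw [map_one]; ring, Polynomial.natDegree_neg, Polynomial.natDegree_X_add_C]
  · exact ⟨-1, -1, by ring⟩
  · rwa [Polynomial.natDegree_C_mul_X_pow d c hc]
  · rw [show (-Polynomial.X - 1 : Polynomial ℂ) = -(Polynomial.X + Polynomial.C 1) by rw [map_one]; ring,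
      Polynomial.leadingCoeff_neg, Polynomial.leadingCoeff_X_add_C, Polynomial.leadingCoeff_X,
      Complex.exp_zero]
    ring

/-- **`{x₁ = x₀³, x₀ y₀ = x₀ + 1}` has Zariski-dense exponential points** (a totally degenerate,
non-resonant member over a CUBIC base: the phases `exp(P̃(2πik))`, `P̃ = X³ + 3X`, are
`exp(-i(8π³k³ - 6πk))`, of modulus one and not convergent).
[cite: MantovaMasser2023, §1 Further remarks, p. 5 (the question, open in general)] (new) -/
theorem unprojectedDense_cubicGraph_ratFibre :
    UnprojectedDense {w : Fin 2 ⊕ Fin 2 → ℂ |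
      w (Sum.inl 1) = w (Sum.inl 0) ^ 3 ∧ w (Sum.inl 0) * w (Sum.inr 0) - w (Sum.inl 0) - 1 = 0} := by
  have h := (unprojectedDensityQuestion_monomialGraph_ratFibre one_ne_zero (by norm_num : 2 ≤ 3)).2
  simpa only [one_mul] using h

end Examples

end Summit.Schanuel.Schanuel.Theorems
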